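import Mathlib.Analysis.Convolution
import Literature.MathematicalPhysics.QuantumLattice.LiebWuIntegralEquationsExistence
import HarnessLib

/-!
# The filling of the `B = ∞` Lieb–Wu solution: `N/N_a = 2∫σ` (Lieb–Wu 2003, Theorem 2: `2M = N`)

Family `hubbard`. Lieb–Wu, PRL 20 (1968) 1445, statement (b) "`M/N = ½` at `B = ∞`" = Lieb–Wu,
Physica A 321 (2003) 1, §5, THEOREM 2 ("When `B = ∞` we have `2M = N`"), proved there by integrating
the `σ`-equation over `ℝ` (eq. (mn): `N/N_a = ∫_{-Q}^{Q} ρ = ∫_ℝ σ + ∫_{-B}^{B} σ`). For the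
Neumann-series solution `σ_Q = liebWuSigmaAt U Q`, `ρ_Q = liebWuRhoAt U Q` (`U > 0`, `0 < Q ≤ π`) of
`LiebWuNeumannSeries` / `LiebWuIntegralEquationsExistence` this file PROVES

* `liebWuFillingAtCutoff_eq_two_mul_integral` (**Theorem 2 at `B = ∞`**): `N/N_a = ∫_{-Q}^{Q} ρ_Q = 2∫_ℝ σ_Q`
  (from `ρ_Q = 1/2π + cos k (σ_Q ∗ K)(sin k)`, the substitution `x = sin k`, and the integrated
  fixed-point equation `∫σ_Q = Q/2π + ½∫_{(-a,a]} σ_Q ∗ K`), i.e. `liebWuDownSpinDensity univ σ_Q = (N/N_a)/2`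
  (`liebWuDownSpinDensity_univ_liebWuSigmaAt`), with the bounds `Q/π ≤ N/N_a ≤ 2Q/π`;

and the cutoff-dependence lemmas for the operator `Ŵ_Q = R̂ÂK̂` of eq. (W) used by
`LiebWuFillingContinuity`: `∫Ŵh = ½∫_{(-a,a]} h ∗ K` (`integral_liebWuW`), linearity, `|Ŵh| ≤ Ŵ|h|`,
"`Â` has a kernel that increases with `a`" (`liebWuW_mono_cutoff`, Lieb–Wu 2003, proof of Lemma 4) and
`∫|Ŵ_Q h - Ŵ_{Q'} h| ≤ (πc)⁻¹ (∫h) |sin Q - sin Q'|`. No definition, no named fact.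

## References

* E. H. Lieb, F. Y. Wu, Physica A 321 (2003) 1–27 = arXiv:cond-mat/0207529, §5, Theorems 1–2, eqs. (S),
  (W), (mn), proof of Lemma 4 (key `LiebWuPhysicaA2003`); PRL 20 (1968) 1445, eqs. (15)–(16), statement (b)
  (key `LiebWuPRL1968`).
-/

noncomputable section

open MeasureTheory Set Real Filter intervalIntegral
open Literature.Analysis.SpecialFunctions Literature.Analysis.FunctionSpaces
open scoped Convolution Topology

namespace Literature.MathematicalPhysics.QuantumLattice

namespace LiebWuFilling

variable {f g : ℝ → ℝ} {B : ℝ}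

/-- `t ↦ f(t) g(x - t)` is integrable for `f ∈ L¹`, `g` bounded continuous. [folklore] -/
private theorem integrable_mul_sub (hf : Integrable f) (hgc : Continuous g) (hgB : ∀ y, |g y| ≤ B)
    (x : ℝ) : Integrable fun t => f t * g (x - t) :=
  hf.mul_bdd (hgc.comp (continuous_const.sub continuous_id)).aestronglyMeasurable
    (Eventually.of_forall fun t => by rw [Real.norm_eq_abs]; exact hgB _)

/-- `x ↦ ∫ f(t) g(x - t) dt` is Mathlib's convolution for the multiplication pairing. [folklore] -/
private theorem conv_eq_convolution (f g : ℝ → ℝ) :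
    (fun x => ∫ t, f t * g (x - t)) = f ⋆[ContinuousLinearMap.mul ℝ ℝ, volume] g := by
  funext x
  rw [convolution_def]
  simp only [ContinuousLinearMap.mul_apply']

/-- `x ↦ ∫ f(t) g(x - t) dt` is continuous for `f ∈ L¹`, `g` bounded continuous. [folklore] -/
private theorem continuous_conv (hf : Integrable f) (hgc : Continuous g) (hgB : ∀ y, |g y| ≤ B) :
    Continuous fun x => ∫ t, f t * g (x - t) := by
  rw [conv_eq_convolution]
  refine BddAbove.continuous_convolution_right_of_integrable (L := ContinuousLinearMap.mul ℝ ℝ)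
    ⟨B, ?_⟩ hf hgc
  rintro _ ⟨y, rfl⟩
  exact (Real.norm_eq_abs _).trans_le (hgB y)

/-- `∫∫ f(t) g(x - t) dt dx = (∫ f)(∫ g)` for `f, g ∈ L¹`, and the convolution is integrable. [folklore] -/
private theorem integrable_conv_and_integral (hf : Integrable f) (hg : Integrable g) :
    Integrable (fun x => ∫ t, f t * g (x - t)) ∧
      ∫ x, ∫ t, f t * g (x - t) = (∫ t, f t) * ∫ y, g y := by
  rw [conv_eq_convolution]
  exact ⟨hf.integrable_convolution _ hg, by
    rw [integral_convolution (L := ContinuousLinearMap.mul ℝ ℝ) hf hg]; rfl⟩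

/-- `0 ≤ ∫ f(t) g(x - t) dt ≤ B ∫ f` for `f, g ≥ 0`, `g ≤ B`, `f ∈ L¹`. [folklore] -/
private theorem conv_nonneg_le (hf : Integrable f) (hf0 : ∀ t, 0 ≤ f t) (hg0 : ∀ y, 0 ≤ g y)
    (hgB : ∀ y, g y ≤ B) (x : ℝ) :
    0 ≤ ∫ t, f t * g (x - t) ∧ ∫ t, f t * g (x - t) ≤ B * ∫ t, f t := by
  refine ⟨integral_nonneg fun t => mul_nonneg (hf0 t) (hg0 _), ?_⟩
  rw [← MeasureTheory.integral_const_mul]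
  refine integral_mono_of_nonneg (Eventually.of_forall fun t => mul_nonneg (hf0 t) (hg0 _))
    (hf.const_mul B) (Eventually.of_forall fun t => ?_)
  dsimp only
  rw [mul_comm B]
  exact mul_le_mul_of_nonneg_left (hgB _) (hf0 t)

/-- `0 ≤ 1_s ≤ 1`. [folklore] -/
private theorem indicator_one_mem_Icc (s : Set ℝ) (y : ℝ) :
    0 ≤ s.indicator (fun _ => (1 : ℝ)) y ∧ s.indicator (fun _ => (1 : ℝ)) y ≤ 1 := by
  by_cases hy : y ∈ s
  · simp [indicator_of_mem hy]
  · simp [indicator_of_notMem hy]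

end LiebWuFilling

open LiebWuFilling

section Filling

variable {U Q Q' : ℝ} {h h₁ h₂ : ℝ → ℝ}

/-! ### The operator `Ŵ_Q`: exact integral, linearity, positivity, monotonicity in the cutoff -/

/-- The `y`-integrand of `Ŵh(x)` is integrable (`h ∈ L¹`). [cite: LiebWuPhysicaA2003, §5, eq. (W)] -/
private theorem integrable_liebWuW_integrand (hU : 0 < U) (Q : ℝ) (hhi : Integrable h) (x : ℝ) :
    Integrable fun y => (Ioc (-Real.sin Q) (Real.sin Q)).indicator (fun _ => (1 : ℝ)) y *
      (∫ t, h t * cauchyDensity (U / 4) (y - t)) * sechKernel (U / 4) (x - y) := by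
  have hc : 0 < U / 4 := by positivity
  obtain ⟨hGi, -⟩ := integrable_conv_and_integral hhi (integrable_cauchyDensity hc.le)
  have h1 : Integrable fun y => (Ioc (-Real.sin Q) (Real.sin Q)).indicator (fun _ => (1 : ℝ)) y *
      ∫ t, h t * cauchyDensity (U / 4) (y - t) :=
    hGi.bdd_mul (aestronglyMeasurable_const.indicator measurableSet_Ioc)
      (Eventually.of_forall fun y => by
        rw [Real.norm_eq_abs, abs_of_nonneg (indicator_one_mem_Icc _ y).1]
        exact (indicator_one_mem_Icc _ y).2)
  exact h1.mul_bdd ((continuous_sechKernel hc).comp (continuous_const.sub continuous_id)).aestronglyMeasurable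
    (Eventually.of_forall fun y => by
      rw [Real.norm_eq_abs, abs_of_pos (sechKernel_pos hc _)]; exact sechKernel_le hc _)

/-- **`∫ Ŵh = ½ ∫_{(-a,a]} (h ∗ K)`** (`∫ r = 1`; `a = sin Q`). [cite: LiebWuPhysicaA2003, §5, eq. (W)] -/
theorem integral_liebWuW (hU : 0 < U) (Q : ℝ) (hhi : Integrable h) :
    ∫ x, liebWuW U Q h x =
      1 / 2 * ∫ y in Ioc (-Real.sin Q) (Real.sin Q), ∫ t, h t * cauchyDensity (U / 4) (y - t) := by
  have hc : 0 < U / 4 := by positivity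
  obtain ⟨hGi, -⟩ := integrable_conv_and_integral hhi (integrable_cauchyDensity hc.le)
  have hFi : Integrable fun y => (Ioc (-Real.sin Q) (Real.sin Q)).indicator (fun _ => (1 : ℝ)) y *
      ∫ t, h t * cauchyDensity (U / 4) (y - t) :=
    hGi.bdd_mul (aestronglyMeasurable_const.indicator measurableSet_Ioc)
      (Eventually.of_forall fun y => by
        rw [Real.norm_eq_abs, abs_of_nonneg (indicator_one_mem_Icc _ y).1]
        exact (indicator_one_mem_Icc _ y).2)
  obtain ⟨-, hFrint⟩ := integrable_conv_and_integral hFi (integrable_sechKernel hc)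
  rw [integral_sechKernel hc, mul_one] at hFrint
  have hW : (fun x => liebWuW U Q h x) = fun x => 1 / 2 * ∫ y,
      ((Ioc (-Real.sin Q) (Real.sin Q)).indicator (fun _ => (1 : ℝ)) y *
        ∫ t, h t * cauchyDensity (U / 4) (y - t)) * sechKernel (U / 4) (x - y) := by
    funext x; rw [liebWuW]
  rw [hW, MeasureTheory.integral_const_mul, hFrint,
    ← MeasureTheory.integral_indicator (measurableSet_Ioc : MeasurableSet (Ioc (-Real.sin Q) (Real.sin Q)))]
  congr 1
  refine MeasureTheory.integral_congr_ae (Eventually.of_forall fun y => ?_)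
  by_cases hy : y ∈ Ioc (-Real.sin Q) (Real.sin Q)
  · simp [indicator_of_mem hy]
  · simp [indicator_of_notMem hy]

/-- Linearity of `Ŵ` on `L¹`. [cite: LiebWuPhysicaA2003, §5, eq. (W)] -/
theorem liebWuW_sub (hU : 0 < U) (Q : ℝ) (h₁i : Integrable h₁) (h₂i : Integrable h₂) (x : ℝ) :
    liebWuW U Q h₁ x - liebWuW U Q h₂ x = liebWuW U Q (fun t => h₁ t - h₂ t) x := by
  have hc : 0 < U / 4 := by positivity
  have hKB : ∀ z, |cauchyDensity (U / 4) z| ≤ 1 / (π * (U / 4)) := fun z => by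
    rw [abs_of_pos (cauchyDensity_pos hc z)]; exact cauchyDensity_le hc z
  simp only [liebWuW]
  rw [← mul_sub, ← integral_sub (integrable_liebWuW_integrand hU Q h₁i x)
    (integrable_liebWuW_integrand hU Q h₂i x)]
  congr 1
  refine MeasureTheory.integral_congr_ae (Eventually.of_forall fun y => ?_)
  have hG : ∫ t, (h₁ t - h₂ t) * cauchyDensity (U / 4) (y - t) =
      (∫ t, h₁ t * cauchyDensity (U / 4) (y - t)) - ∫ t, h₂ t * cauchyDensity (U / 4) (y - t) := by
    rw [← integral_sub (integrable_mul_sub h₁i (continuous_cauchyDensity hc) hKB y)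
      (integrable_mul_sub h₂i (continuous_cauchyDensity hc) hKB y)]
    refine MeasureTheory.integral_congr_ae (Eventually.of_forall fun t => ?_)
    ring
  dsimp only
  rw [hG]
  ring

/-- `Ŵ` has a positive kernel: `|Ŵh| ≤ Ŵ|h|`. [cite: LiebWuPhysicaA2003, §5, proof of Theorem 1] -/
theorem abs_liebWuW_le (hU : 0 < U) (Q : ℝ) (hhi : Integrable h) (x : ℝ) :
    |liebWuW U Q h x| ≤ liebWuW U Q (fun t => |h t|) x := by
  have hc : 0 < U / 4 := by positivity
  simp only [liebWuW]
  rw [abs_mul, abs_of_pos (by norm_num : (0 : ℝ) < 1 / 2)]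
  refine mul_le_mul_of_nonneg_left (abs_integral_le_integral_abs.trans ?_) (by norm_num)
  refine integral_mono_of_nonneg (Eventually.of_forall fun y => abs_nonneg _)
    (integrable_liebWuW_integrand hU Q hhi.abs x) (Eventually.of_forall fun y => ?_)
  have hA := indicator_one_mem_Icc (Ioc (-Real.sin Q) (Real.sin Q)) y
  dsimp only
  rw [abs_mul, abs_mul, abs_of_nonneg hA.1, abs_of_pos (sechKernel_pos hc _)]
  refine mul_le_mul_of_nonneg_right (mul_le_mul_of_nonneg_left ?_ hA.1) (sechKernel_pos hc _).le
  refine abs_integral_le_integral_abs.trans (le_of_eq ?_)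
  refine MeasureTheory.integral_congr_ae (Eventually.of_forall fun t => ?_)
  dsimp only
  rw [abs_mul, abs_of_pos (cauchyDensity_pos hc _)]

/-- **The kernel of `Ŵ_Q = R̂ÂK̂` increases with `a = sin Q`** ("`Â` has a kernel that increases with
`a`"): `Ŵ_{Q'}h ≤ Ŵ_Q h` for `h ≥ 0` when `sin Q' ≤ sin Q`. [cite: LiebWuPhysicaA2003, §5, proof of Lemma 4] -/
theorem liebWuW_mono_cutoff (hU : 0 < U) (hhi : Integrable h) (hh0 : ∀ t, 0 ≤ h t)
    (hs : Real.sin Q' ≤ Real.sin Q) (x : ℝ) : liebWuW U Q' h x ≤ liebWuW U Q h x := by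
  have hc : 0 < U / 4 := by positivity
  simp only [liebWuW]
  refine mul_le_mul_of_nonneg_left ?_ (by norm_num)
  refine integral_mono (integrable_liebWuW_integrand hU Q' hhi x)
    (integrable_liebWuW_integrand hU Q hhi x) fun y => ?_
  have hG0 : 0 ≤ ∫ t, h t * cauchyDensity (U / 4) (y - t) :=
    integral_nonneg fun t => mul_nonneg (hh0 t) (cauchyDensity_pos hc _).le
  dsimp only
  refine mul_le_mul_of_nonneg_right (mul_le_mul_of_nonneg_right ?_ hG0) (sechKernel_pos hc _).le
  exact indicator_le_indicator_of_subset (Ioc_subset_Ioc (neg_le_neg hs) hs) (fun _ => zero_le_one) y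

/-- `L¹`-dependence of `Ŵ_Q h` on the cutoff (case `0 ≤ sin Q' ≤ sin Q`):
`∫ |Ŵ_Q h - Ŵ_{Q'} h| = ½ |∫_{(-a,a]} h∗K - ∫_{(-a',a']} h∗K| ≤ (sup h∗K)(a - a') ≤ (πc)⁻¹ (∫h)(a - a')`.
[cite: LiebWuPhysicaA2003, §5, eq. (W)] -/
private theorem integral_abs_liebWuW_sub_cutoff_aux (hU : 0 < U) (hhi : Integrable h) (hh0 : ∀ t, 0 ≤ h t)
    (hs0 : 0 ≤ Real.sin Q') (hs : Real.sin Q' ≤ Real.sin Q) :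
    ∫ x, |liebWuW U Q h x - liebWuW U Q' h x| ≤
      1 / (π * (U / 4)) * (∫ t, h t) * (Real.sin Q - Real.sin Q') := by
  have hc : 0 < U / 4 := by positivity
  have hKB : ∀ z, |cauchyDensity (U / 4) z| ≤ 1 / (π * (U / 4)) := fun z => by
    rw [abs_of_pos (cauchyDensity_pos hc z)]; exact cauchyDensity_le hc z
  have hGc : Continuous fun y => ∫ t, h t * cauchyDensity (U / 4) (y - t) :=
    continuous_conv hhi (continuous_cauchyDensity hc) hKB
  have hGB : ∀ y, ‖∫ t, h t * cauchyDensity (U / 4) (y - t)‖ ≤ 1 / (π * (U / 4)) * ∫ t, h t := by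
    intro y
    obtain ⟨h0, hle⟩ := conv_nonneg_le hhi hh0 (fun z => (cauchyDensity_pos hc z).le)
      (cauchyDensity_le hc) y
    rw [Real.norm_of_nonneg h0]
    exact hle
  obtain ⟨-, -, hWi, -⟩ := liebWuW_props (Q := Q) hU hhi hh0
  obtain ⟨-, -, hWi', -⟩ := liebWuW_props (Q := Q') hU hhi hh0
  have habs : ∀ x, |liebWuW U Q h x - liebWuW U Q' h x| = liebWuW U Q h x - liebWuW U Q' h x :=
    fun x => abs_of_nonneg (sub_nonneg.2 (liebWuW_mono_cutoff hU hhi hh0 hs x))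
  simp_rw [habs]
  rw [integral_sub hWi hWi', integral_liebWuW hU Q hhi, integral_liebWuW hU Q' hhi, ← mul_sub,
    ← intervalIntegral.integral_of_le (by linarith : -Real.sin Q ≤ Real.sin Q),
    ← intervalIntegral.integral_of_le (by linarith : -Real.sin Q' ≤ Real.sin Q'),
    intervalIntegral.integral_interval_sub_interval_comm (hGc.intervalIntegrable _ _)
      (hGc.intervalIntegrable _ _) (hGc.intervalIntegrable _ _)]
  have h1 := intervalIntegral.norm_integral_le_of_norm_le_const (a := -Real.sin Q) (b := -Real.sin Q')
    fun y _ => hGB y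
  have h2 := intervalIntegral.norm_integral_le_of_norm_le_const (a := Real.sin Q) (b := Real.sin Q')
    fun y _ => hGB y
  rw [Real.norm_eq_abs, show |-Real.sin Q' - -Real.sin Q| = Real.sin Q - Real.sin Q' by
    rw [abs_of_nonneg (by linarith)]; ring] at h1
  rw [Real.norm_eq_abs, show |Real.sin Q' - Real.sin Q| = Real.sin Q - Real.sin Q' by
    rw [abs_sub_comm, abs_of_nonneg (by linarith)]] at h2
  have hI0 : 0 ≤ ∫ t, h t := integral_nonneg hh0
  calc 1 / 2 * ((∫ y in -Real.sin Q..-Real.sin Q', ∫ t, h t * cauchyDensity (U / 4) (y - t)) -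
        ∫ y in Real.sin Q..Real.sin Q', ∫ t, h t * cauchyDensity (U / 4) (y - t))
      ≤ 1 / 2 * (|∫ y in -Real.sin Q..-Real.sin Q', ∫ t, h t * cauchyDensity (U / 4) (y - t)| +
          |∫ y in Real.sin Q..Real.sin Q', ∫ t, h t * cauchyDensity (U / 4) (y - t)|) := by
        refine mul_le_mul_of_nonneg_left ?_ (by norm_num)
        linarith [le_abs_self (∫ y in -Real.sin Q..-Real.sin Q', ∫ t, h t * cauchyDensity (U / 4) (y - t)),
          neg_abs_le (∫ y in Real.sin Q..Real.sin Q', ∫ t, h t * cauchyDensity (U / 4) (y - t))]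
    _ ≤ 1 / 2 * (1 / (π * (U / 4)) * (∫ t, h t) * (Real.sin Q - Real.sin Q') +
          1 / (π * (U / 4)) * (∫ t, h t) * (Real.sin Q - Real.sin Q')) :=
        mul_le_mul_of_nonneg_left (add_le_add h1 h2) (by norm_num)
    _ = 1 / (π * (U / 4)) * (∫ t, h t) * (Real.sin Q - Real.sin Q') := by ring

/-- **`L¹`-dependence of `Ŵ_Q h` on the cutoff** (`0 ≤ Q, Q' ≤ π`, `h ≥ 0`):
`∫ |Ŵ_Q h - Ŵ_{Q'} h| ≤ (πc)⁻¹ (∫h) |sin Q - sin Q'|`, `c = U/4`. [cite: LiebWuPhysicaA2003, §5, eq. (W)] -/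
theorem integral_abs_liebWuW_sub_cutoff_le (hU : 0 < U) (hhi : Integrable h) (hh0 : ∀ t, 0 ≤ h t)
    (hQ0 : 0 ≤ Q) (hQπ : Q ≤ π) (hQ'0 : 0 ≤ Q') (hQ'π : Q' ≤ π) :
    ∫ x, |liebWuW U Q h x - liebWuW U Q' h x| ≤
      1 / (π * (U / 4)) * (∫ t, h t) * |Real.sin Q - Real.sin Q'| := by
  have hsQ := Real.sin_nonneg_of_nonneg_of_le_pi hQ0 hQπ
  have hsQ' := Real.sin_nonneg_of_nonneg_of_le_pi hQ'0 hQ'π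
  rcases le_total (Real.sin Q') (Real.sin Q) with hs | hs
  · rw [abs_of_nonneg (sub_nonneg.2 hs)]
    exact integral_abs_liebWuW_sub_cutoff_aux hU hhi hh0 hsQ' hs
  · rw [abs_sub_comm, abs_of_nonneg (sub_nonneg.2 hs)]
    have heq : ∀ x, |liebWuW U Q h x - liebWuW U Q' h x| = |liebWuW U Q' h x - liebWuW U Q h x| :=
      fun x => abs_sub_comm _ _
    simp_rw [heq]
    exact integral_abs_liebWuW_sub_cutoff_aux hU hhi hh0 hsQ hs

/-! ### Theorem 2 at `B = ∞`: `N/N_a = 2 ∫σ` (`2M = N`) -/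

/-- `∫ σ_Q = ∫ ξ_Q + ∫ Ŵσ_Q = Q/2π + ½ ∫_{(-a,a]} σ_Q ∗ K` (integrating the fixed-point equation (S)).
[cite: LiebWuPhysicaA2003, §5, eqs. (S), (mn)] -/
theorem integral_liebWuSigmaAt_eq (hU : 0 < U) (hQ : 0 < Q) :
    ∫ x, liebWuSigmaAt U Q x = Q / (2 * π) + 1 / 2 * ∫ y in Ioc (-Real.sin Q) (Real.sin Q),
      ∫ t, liebWuSigmaAt U Q t * cauchyDensity (U / 4) (y - t) := by
  have hσi := integrable_liebWuSigmaAt hU hQ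
  have hσ0 : ∀ t, 0 ≤ liebWuSigmaAt U Q t := fun t => (liebWuSigmaAt_pos hU hQ t).le
  obtain ⟨hξi, hξI⟩ := integrable_liebWuXi_and_integral hU hQ
  obtain ⟨-, -, hWi, -⟩ := liebWuW_props (Q := Q) hU hσi hσ0
  calc ∫ x, liebWuSigmaAt U Q x = ∫ x, (liebWuXi U Q x + liebWuW U Q (liebWuSigmaAt U Q) x) :=
        MeasureTheory.integral_congr_ae (Eventually.of_forall (liebWuSigmaAt_eq_xi_add_W hU hQ))
    _ = _ := by rw [integral_add hξi hWi, hξI, integral_liebWuW hU Q hσi]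

/-- **`Q/2π ≤ ∫ σ_Q ≤ Q/π`** (`0 ≤ ∫Ŵσ ≤ ½∫σ`). [cite: LiebWuPhysicaA2003, §5, proof of Theorem 1] -/
theorem integral_liebWuSigmaAt_mem_Icc (hU : 0 < U) (hQ : 0 < Q) :
    ∫ x, liebWuSigmaAt U Q x ∈ Icc (Q / (2 * π)) (Q / π) := by
  have hσi := integrable_liebWuSigmaAt hU hQ
  have hσ0 : ∀ t, 0 ≤ liebWuSigmaAt U Q t := fun t => (liebWuSigmaAt_pos hU hQ t).le
  obtain ⟨hξi, hξI⟩ := integrable_liebWuXi_and_integral hU hQ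
  obtain ⟨-, hW0, hWi, hWint, -⟩ := liebWuW_props (Q := Q) hU hσi hσ0
  have h : ∫ x, liebWuSigmaAt U Q x = Q / (2 * π) + ∫ x, liebWuW U Q (liebWuSigmaAt U Q) x := by
    calc ∫ x, liebWuSigmaAt U Q x = ∫ x, (liebWuXi U Q x + liebWuW U Q (liebWuSigmaAt U Q) x) :=
          MeasureTheory.integral_congr_ae (Eventually.of_forall (liebWuSigmaAt_eq_xi_add_W hU hQ))
      _ = _ := by rw [integral_add hξi hWi, hξI]
  have hW0' : 0 ≤ ∫ x, liebWuW U Q (liebWuSigmaAt U Q) x := integral_nonneg hW0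
  constructor
  · linarith
  · have : Q / π = 2 * (Q / (2 * π)) := by ring
    linarith

/-- **Lieb–Wu 2003, Theorem 2 at `B = ∞` (`2M = N`), for the Neumann-series solution:**
`N/N_a = ∫_{-Q}^{Q} ρ_Q(k) dk = 2 ∫_ℝ σ_Q` — eq. (mn) `N/N_a = ∫σ + ∫_{-B}^{B}σ` at `B = ∞`; here obtained
from `ρ_Q = 1/2π + cos k (σ_Q ∗ K)(sin k)`, the substitution `x = sin k`, and `∫σ_Q = Q/2π + ½∫_{(-a,a]} σ_Q ∗ K`.
[cite: LiebWuPhysicaA2003, §5, Theorem 2 and eq. (mn)] -/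
theorem liebWuFillingAtCutoff_eq_two_mul_integral (hU : 0 < U) (hQ : 0 < Q) (hQπ : Q ≤ π) :
    liebWuFillingAtCutoff U Q = 2 * ∫ x, liebWuSigmaAt U Q x := by
  have hc : 0 < U / 4 := by positivity
  have ha0 : 0 ≤ Real.sin Q := Real.sin_nonneg_of_nonneg_of_le_pi hQ.le hQπ
  have hσi := integrable_liebWuSigmaAt hU hQ
  have hKB : ∀ z, |cauchyDensity (U / 4) z| ≤ 1 / (π * (U / 4)) := fun z => by
    rw [abs_of_pos (cauchyDensity_pos hc z)]; exact cauchyDensity_le hc z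
  have hGc : Continuous fun y => ∫ t, liebWuSigmaAt U Q t * cauchyDensity (U / 4) (y - t) :=
    continuous_conv hσi (continuous_cauchyDensity hc) hKB
  have hsub := intervalIntegral.integral_comp_mul_deriv (a := -Q) (b := Q)
    (fun k _ => Real.hasDerivAt_sin k) Real.continuous_cos.continuousOn hGc
  rw [Real.sin_neg] at hsub
  rw [integral_liebWuSigmaAt_eq hU hQ, ← intervalIntegral.integral_of_le (by linarith), ← hsub]
  unfold liebWuFillingAtCutoff liebWuFilling
  have hρ : ∀ k, liebWuRhoAt U Q k = 1 / (2 * π) +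
      ((fun y => ∫ t, liebWuSigmaAt U Q t * cauchyDensity (U / 4) (y - t)) ∘ Real.sin) k * Real.cos k := by
    intro k
    simp only [liebWuRhoAt, Function.comp_apply]
    ring
  simp_rw [hρ]
  have hi1 : IntervalIntegrable (fun _ => 1 / (2 * π)) volume (-Q) Q := intervalIntegrable_const
  have hi2 : IntervalIntegrable (fun k =>
      ((fun y => ∫ t, liebWuSigmaAt U Q t * cauchyDensity (U / 4) (y - t)) ∘ Real.sin) k * Real.cos k)
      volume (-Q) Q := ((hGc.comp Real.continuous_sin).mul Real.continuous_cos).intervalIntegrable _ _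
  rw [intervalIntegral.integral_add hi1 hi2, intervalIntegral.integral_const, smul_eq_mul]
  ring

/-- **Statement (b) at `B = ∞`: `M/N_a = ½ N/N_a`** (eq. (16) over `ℝ`; `S_z = 0`).
[cite: LiebWuPRL1968, eq. (16) and statement (b)] -/
theorem liebWuDownSpinDensity_univ_liebWuSigmaAt (hU : 0 < U) (hQ : 0 < Q) (hQπ : Q ≤ π) :
    liebWuDownSpinDensity univ (liebWuSigmaAt U Q) = liebWuFillingAtCutoff U Q / 2 := by
  rw [liebWuDownSpinDensity_univ, liebWuFillingAtCutoff_eq_two_mul_integral hU hQ hQπ]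
  ring

/-- **`Q/π ≤ N/N_a ≤ 2Q/π`** for the solution with cutoff `Q`. [cite: LiebWuPhysicaA2003, §5, Theorems 1–2] -/
theorem liebWuFillingAtCutoff_mem_Icc (hU : 0 < U) (hQ : 0 < Q) (hQπ : Q ≤ π) :
    liebWuFillingAtCutoff U Q ∈ Icc (Q / π) (2 * Q / π) := by
  obtain ⟨h1, h2⟩ := integral_liebWuSigmaAt_mem_Icc hU hQ
  rw [liebWuFillingAtCutoff_eq_two_mul_integral hU hQ hQπ]
  constructor
  · have : Q / π = 2 * (Q / (2 * π)) := by ring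
    linarith
  · have : 2 * Q / π = 2 * (Q / π) := by ring
    linarith

/-- The filling is positive. [cite: LiebWuPhysicaA2003, §5, Theorems 1–2] -/
theorem liebWuFillingAtCutoff_pos (hU : 0 < U) (hQ : 0 < Q) (hQπ : Q ≤ π) :
    0 < liebWuFillingAtCutoff U Q :=
  lt_of_lt_of_le (by positivity) (liebWuFillingAtCutoff_mem_Icc hU hQ hQπ).1

end Filling

end Literature.MathematicalPhysics.QuantumLattice

end
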